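import Summits.RiemannHypothesis.RiemannHypothesis.Theses.Strip
import Summits.RiemannHypothesis.RiemannHypothesis.Theses.RuelleBand

/-!
# Piece DEFINITIONS for the BC2 probes of `Strip.StripThesis` (no theorems in this file)

The probes (`bc/probes_S.lean`, `bc/probes_X.lean`) import only this file (hence the two route files
and Mathlib; NO Literature dictionary, NO strategist theorems), as the BC2 recipe prescribes.
-/

set_option linter.dupNamespace false

noncomputable section

namespace Summit.RiemannHypothesis.RiemannHypothesis.Cruxes.StripThesis.Pieces

open Filter Asymptotics
open Summit.RiemannHypothesis.RiemannHypothesis.Theses.Strip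

/-- D-A bridge piece `#2 → X`. -/
def StripPropagation : Prop := StripZeroFreeStrip → StripThesis

/-- D-A dichotomy "Θ⁺ ∉ (1/2,1)" (quasi-RH at one abscissa in (1/2,1) forces X). -/
def StripDichotomy : Prop :=
  ∀ σ₀ : ℝ, 1 / 2 < σ₀ → σ₀ < 1 →
    (∀ s : ℂ, riemannZeta s = 0 → σ₀ < s.re → s.re < 1 → False) → StripThesis

/-- D-Q fixed-abscissa quasi-RH `QRH(σ)` (Mathlib-only copy of Literature `QuasiRiemannHypothesis σ`). -/
def QRHAt (σ : ℝ) : Prop := ∀ s : ℂ, riemannZeta s = 0 → σ < s.re → s.re < 1 → False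

/-- D-M Mertens ε-form. -/
def MertensHalf : Prop :=
  ∀ ε : ℝ, 0 < ε →
    (fun x : ℝ => ((∑ n ∈ Finset.Ioc 0 ⌊x⌋₊, ArithmeticFunction.moebius n : ℤ) : ℝ)) =O[atTop]
      fun x : ℝ => x ^ (1 / 2 + ε)

/-- D-O upper one-sided half. -/
def MertensUpperHalf : Prop :=
  ∀ ε : ℝ, 0 < ε → ∀ᶠ x : ℝ in atTop,
    ((∑ n ∈ Finset.Ioc 0 ⌊x⌋₊, ArithmeticFunction.moebius n : ℤ) : ℝ) ≤ x ^ (1 / 2 + ε)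

/-- D-O lower one-sided half. -/
def MertensLowerHalf : Prop :=
  ∀ ε : ℝ, 0 < ε → ∀ᶠ x : ℝ in atTop,
    -x ^ (1 / 2 + ε) ≤ ((∑ n ∈ Finset.Ioc 0 ⌊x⌋₊, ArithmeticFunction.moebius n : ℤ) : ℝ)

/-- D-H low piece (height ≤ T, both signs). -/
def RHUpToAbs (T : ℝ) : Prop :=
  ∀ s : ℂ, riemannZeta s = 0 → 0 < s.re → s.re < 1 → |s.im| ≤ T → s.re = 1 / 2

/-- D-H high piece (height > T). -/
def RHAbove (T : ℝ) : Prop :=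
  ∀ s : ℂ, riemannZeta s = 0 → 0 < s.re → s.re < 1 → T < |s.im| → s.re = 1 / 2

end Summit.RiemannHypothesis.RiemannHypothesis.Cruxes.StripThesis.Pieces

end
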